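import Summits.BirchSwinnertonDyer.BirchSwinnertonDyer.Theorems.GenusKolyvaginAtTwoPowDvdShaCardAtTwoPosTKolyvaginSuppliesTransposition
import Summits.BirchSwinnertonDyer.BirchSwinnertonDyer.Theorems.GenusKolyvaginAtTwoPowDvdShaCardAtTwoPosTXOrthTransposition
import Summits.BirchSwinnertonDyer.BirchSwinnertonDyer.Theorems.GenusKolyvaginAtTwoPowDvdShaCardAtTwoRTOrthogonalCapstoneRankLeOne
import Summits.BirchSwinnertonDyer.BirchSwinnertonDyer.Theorems.GenusKolyvaginAtTwoPowDvdShaCardAtTwoRTNonPhantomPowAtMultiplicative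
import Summits.BirchSwinnertonDyer.BirchSwinnertonDyer.Theorems.GenusKolyvaginAtTwoPowDvdShaCardAtTwoPosTRankLeOnePosCut
import HarnessLib

/-!
# Route `GenusKolyvaginAtTwo`, crux L⁺_T `PowDvdShaCardAtTwoPosT` (stmt-BirchSwinnertonDyer-23379) — ROAD (E4)⁺ ASSEMBLED: the conclusion
# `2^(2M₀) ∣ #Ш(E/K)[2^∞]` of the RESTATED item L⁺_T′ (LEAD R9-FINAL, = this seat's R9-L: Q2, an odd multiplicative prime, the Δ>0 cut, a
# TRANSPOSITION-DEEP witness) from FOUR named sockets — the Čebotarev socket and the three KS⁺ sockets hbot⁺ / hswap⁺ / hK⁺ — and nothing else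

Seat `bsd-line-gk2-p2` g22 (PROVER seat 2/3, cell `bsd-f1-sign2`), `--supports stmt-BirchSwinnertonDyer-23379` (helper; closes nothing).
THEOREMS ONLY (no definition, no named fact, no `sorry`).  BSD is NOT proved by any of this; L⁺_T (as filed or restated) is NOT proved: the four
sockets are DISPLAYED HYPOTHESES (owners per LEAD ruling R10′: hCheb + hswap⁺ = gk2-p5 g32, hK⁺ = gk2-p4 g24, hbot⁺ = gk2-p3).

WHAT.  `pow_dvd_natCard_sha_of_sockets_of_rank_le_one_transposition` — binders = the K-side of the L⁺_T′ frame (Q2; `W` non-CM, odd Tamagawa product, an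
odd multiplicative place `v` — ANY sign of `Δ`; `K` imaginary quadratic, `d_K` odd `≠ −3`, Heegner, the two non-square clauses, `ρ_{E,2^n}` onto;
`(Dt, β, ι, d₁)`, `P(1)` of infinite order with `2^{M₀} ∥ P(1)`; `rank E(K) ≤ 1` DISPLAYED (free on the Δ>0 cut, see below)), then the four
sockets at the level `L := 2(M₀+6)`, margin `1` (hbot⁺ is where L⁺_T′'s transposition-deep witness `P(n₀) ∉ 2E(K[n₀])` enters), and the conclusion
`2^(2M₀) ∣ #Ш(E/K)[2^∞]`.  Composition = LINE 18's closer `powDvdShaCardAtTwoRT_proof` transcribed: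
* `rank E(K) ≤ 1` is a displayed hypothesis here; on the cut of L⁺_T′ it is FREE: gk2-p5 g31's `stub_b2qSignFree` (B2Q⁺ by name, p755582) ⟹
  `rank E(ℚ) = 0` (gk2-p3 g27 `mordellWeilRank_eq_zero_of_two_pow_smul_selmer_eq_zero`) ⟹ gk2-p3 g27 `exists_frame_of_cut` `.2.1` (with `w = 1`,
  `#Sel₂(Wd) = 2`) — three lines in the by-name closer, kept out of this file so that it does not import the `…PosTOnCut` cone;
* X-ORTH∃ = this seat's `ctOrthogonalAtTwo_of_frame_transposition` (`…PosTXOrthTransposition`, p756885) at `k := M₀ + 6`;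
* KS⁺ = this seat's integrator `kolyvaginSuppliesAtTwo_of_deepSwap_transposition` (`…PosTKolyvaginSuppliesTransposition`) over the class
  `G q := L + 1 ≤ idx q ∧ TRANSP q`, (NPh_{L+1}) from the multiplicative place (`NonPhantomPow.nonPhantomAtTwo_of_hasMultiplicativeReductionAt`), fed
  with the four sockets;
* capstone = `pow_dvd_natCard_sha_of_kolyvaginSupplies_of_orthogonal_of_rank_le_one` (p741898) with `Xp = Xm := G`.
The by-name closer of L⁺_T′ = this theorem + the three-line `hrk` + the four socket theorems (hbot⁺ fed with the item's witness).
TRANSP (level-free): `∃ v 𝔓 (h : Γ_ℚ), ℓ ∈ v ∧ 𝔓 ∈ v.primesAbove ∧ IsArithFrobAt (𝓞 ℚ) h 𝔓 ∧ ∃ u : E[2], h • u ≠ u` (`geomTorsion W 2`; the route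
text's `W.geomTorsion ((2 : ℕ) : ℤ)` converts by gk2-p5's `exists_smul_ne_two_of_natCast`).

References: [McCallumLMS1991] §4 Prop. 4.7, §5 Prop. 5.2, Thm. 5.4; [Kolyvagin1991StructureSha]; [Kolyvagin1991MathAnn] Thm. 2.1–2.2; [GrossLMS1991] §3,
§5 Props. 5.3–5.4, §10; [Kramer1981] Thm. 1.
-/

set_option autoImplicit false
-- the Theorems namespace of this sub repeats the summit name by design (D-0017 nested layout)
set_option linter.dupNamespace false

noncomputable section

open scoped Classical
open scoped AddSubgroup
open Function Field NumberField IsDedekindDomain WeierstrassCurve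
open Literature.NumberTheory.EllipticCurves Literature.NumberTheory.GaloisRepresentations
open Literature.NumberTheory.EllipticCurves.ModularForms
open Literature.NumberTheory.GaloisCohomology
open Summit.BirchSwinnertonDyer.Rank1Residual.JET.GlobalDuality
open Summit.BirchSwinnertonDyer.BirchSwinnertonDyer.Theses.GenusKolyvaginAtTwo
open Summit.BirchSwinnertonDyer.Rank1Residual

namespace Summit.BirchSwinnertonDyer.BirchSwinnertonDyer.Theorems.GenusExact.PlusDescent

/-- **ROAD (E4)⁺ ASSEMBLED MODULO ITS FOUR SOCKETS: `2^(2M₀) ∣ #Ш(E/K)[2^∞]` on the K-side of the restated L⁺_T′ frame, ANY sign of `Δ`, given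
`rank E(K) ≤ 1`.**  See the module docstring for the frame, the sockets (`hCheb`, `hbot`, `hswap`, `hK` — stated at the level `L = 2(M₀+6)` with margin `1` over the
class `L + 1 ≤ idx ∧ TRANSP`) and the composition.  NO sign-specific input remains outside the sockets; BSD is not proved by this.
[cite: McCallumLMS1991, §5 Prop. 5.2, Thm. 5.4 (p. 310)] [cite: Kolyvagin1991StructureSha] [cite: Kolyvagin1991MathAnn, Thm. 2.1–2.2]
[cite: GrossLMS1991, §1 Thm. 1.3, §10] [cite: Kramer1981, Thm. 1] -/
theorem pow_dvd_natCard_sha_of_sockets_of_rank_le_one_transposition (hQ2 : KolyvaginRelationAtTwo)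
    (W : WeierstrassCurve ℚ) [W.IsElliptic] [W.IsGloballyMinimal] [NeZero (W.conductorNorm ℤ)] (hcm : ¬ W.HasCM)
    (hT : Odd W.tamagawaProduct) (v : HeightOneSpectrum (𝓞 ℚ)) (h2v : ((2 : ℕ) : 𝓞 ℚ) ∉ v.asIdeal)
    (hNv : ((W.conductorNorm ℤ : ℕ) : 𝓞 ℚ) ∈ v.asIdeal) (hmult : W.HasMultiplicativeReductionAt v)
    (K : Type) [Field K] [NumberField K] (hIQ : IsImaginaryQuadratic K) (hodd : Odd (NumberField.discr K))
    (h3 : NumberField.discr K ≠ -3) (hHe : SatisfiesHeegnerHypothesis (W.conductorNorm ℤ) K)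
    (hsq1 : ¬ IsSquare ((NumberField.discr K : ℚ) * -|W.Δ|)) (hsq2 : ¬ IsSquare ((NumberField.discr K : ℚ) * (-(2 * |W.Δ|))))
    (hρ : ∀ n : ℕ, 0 < n → W.HasSurjectiveModNGaloisRep ((2 : ℤ) ^ n))
    (Dt : ModularParametrizationData W (W.conductorNorm ℤ)) (β : ℤ) (ι : K →+* ℂ) (d₁ : KolyvaginHeegnerData Dt β ι 1)
    (hy : ¬ IsOfFinAddOrder d₁.derivedPoint) (M₀ : ℕ)
    (hdiv : ∃ Q : (W.baseChange (ringClassField K ι 1)).toAffine.Point, ((2 ^ M₀ : ℕ) : ℤ) • Q = d₁.derivedPoint)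
    (hndiv : ¬ ∃ Q : (W.baseChange (ringClassField K ι 1)).toAffine.Point, ((2 ^ (M₀ + 1) : ℕ) : ℤ) • Q = d₁.derivedPoint)
    (hrk : (W.baseChange K).mordellWeilRank ≤ 1)
    (τ : K ≃ₐ[ℚ] K) (hτ : τ ≠ 1)
    -- socket 1 (gk2-p5 g32): the deep full-order signed pair Čebotarev at transposition-deep primes, level `L = 2(M₀+6)`, margin `1`
    (hCheb : ∀ (x y : galH1Torsion (W.baseChange K) ((2 ^ (2 * (M₀ + 6)) : ℕ) : ℤ)) {m κ : ℕ}, 1 ≤ m → 1 ≤ κ →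
      addOrderOf x = 2 ^ m → addOrderOf y = 2 ^ κ → ∀ {sx sy : ℤ}, (sx = 1 ∨ sx = -1) → (sy = 1 ∨ sy = -1) →
      conjAct W τ ((2 ^ (2 * (M₀ + 6)) : ℕ) : ℤ) x = sx • x → conjAct W τ ((2 ^ (2 * (M₀ + 6)) : ℕ) : ℤ) y = sy • y →
      (∀ a b : ℤ, (∀ ρ ∈ torsionFixing (W.baseChange K) ((2 ^ (2 * (M₀ + 6) + 1) : ℕ) : ℤ),
        h1Eval (W.baseChange K) ((2 ^ (2 * (M₀ + 6) + 1) : ℕ) : ℤ)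
          (torsionH1OfDvd (W.baseChange K) (natCast_pow_dvd_natCast_pow_add 2 (2 * (M₀ + 6)) 1) (a • x + b • y)) ρ = 0) →
        a • x + b • y = 0) →
      ∀ X : Finset ℕ, ∃ ℓ : ℕ, ℓ ∉ X ∧ Zhang2014.IsKolyvaginPrime (W.conductorNorm ℤ) W K 2 ℓ ∧
        2 * (M₀ + 6) + 1 ≤ Zhang2014.kolyvaginIndex W 2 ℓ ∧
        (∃ (v : HeightOneSpectrum (𝓞 ℚ)) (𝔓 : Ideal (absIntegers (𝓞 ℚ) ℚ)) (h : absoluteGaloisGroup ℚ),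
          (ℓ : 𝓞 ℚ) ∈ v.asIdeal ∧ 𝔓 ∈ v.primesAbove ∧ IsArithFrobAt (𝓞 ℚ) h 𝔓 ∧ ∃ u : geomTorsion W 2, h • u ≠ u) ∧
        ∀ v : HeightOneSpectrum (𝓞 K), (ℓ : 𝓞 K) ∈ v.asIdeal →
          (∀ j : ℕ, ((2 ^ j : ℕ) : ℤ) • x ∈ (W.baseChange K).torsionLocalKer (v.adicCompletion K) ((2 ^ (2 * (M₀ + 6)) : ℕ) : ℤ) ↔ m ≤ j) ∧
          ∀ j : ℕ, ((2 ^ j : ℕ) : ℤ) • y ∈ (W.baseChange K).torsionLocalKer (v.adicCompletion K) ((2 ^ (2 * (M₀ + 6)) : ℕ) : ℤ) ↔ κ ≤ j)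
    -- socket 2 (gk2-p3, hbot⁺): a 2-primitive bottom rung in the margin class (from L⁺_T′'s transposition-deep witness `P(n₀) ∉ 2E(K[n₀])`)
    (hbot : ∃ (n : ℕ) (d : KolyvaginHeegnerData Dt β ι n), Squarefree n ∧
      (∀ q ∈ n.primeFactors, (Zhang2014.IsKolyvaginPrime (W.conductorNorm ℤ) W K 2 q ∧ 2 * (M₀ + 6) ≤ Zhang2014.kolyvaginIndex W 2 q) ∧
        (2 * (M₀ + 6) + 1 ≤ Zhang2014.kolyvaginIndex W 2 q ∧
          ∃ (v : HeightOneSpectrum (𝓞 ℚ)) (𝔓 : Ideal (absIntegers (𝓞 ℚ) ℚ)) (h : absoluteGaloisGroup ℚ),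
            (q : 𝓞 ℚ) ∈ v.asIdeal ∧ 𝔓 ∈ v.primesAbove ∧ IsArithFrobAt (𝓞 ℚ) h 𝔓 ∧ ∃ u : geomTorsion W 2, h • u ≠ u)) ∧
      addOrderOf (d.kolyvaginClass Nat.prime_two (2 * (M₀ + 6))) = 2 ^ (2 * (M₀ + 6)))
    -- socket 3 (gk2-p5 g32, hswap⁺): the exact prime swap at transposition-deep primes
    (hswap : ∀ (r m : ℕ), 1 ≤ r → m < M₀ →
      (∀ (n : ℕ) (e : KolyvaginHeegnerData Dt β ι n), Squarefree n → n.primeFactors.card = r →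
        (∀ q ∈ n.primeFactors, (Zhang2014.IsKolyvaginPrime (W.conductorNorm ℤ) W K 2 q ∧ 2 * (M₀ + 6) ≤ Zhang2014.kolyvaginIndex W 2 q) ∧
          (2 * (M₀ + 6) + 1 ≤ Zhang2014.kolyvaginIndex W 2 q ∧
            ∃ (v : HeightOneSpectrum (𝓞 ℚ)) (𝔓 : Ideal (absIntegers (𝓞 ℚ) ℚ)) (h : absoluteGaloisGroup ℚ),
              (q : 𝓞 ℚ) ∈ v.asIdeal ∧ 𝔓 ∈ v.primesAbove ∧ IsArithFrobAt (𝓞 ℚ) h 𝔓 ∧ ∃ u : geomTorsion W 2, h • u ≠ u)) →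
        ((2 ^ (2 * (M₀ + 6) - m) : ℕ) : ℤ) • e.kolyvaginClass Nat.prime_two (2 * (M₀ + 6)) = 0) →
      ∀ (n : ℕ) (d : KolyvaginHeegnerData Dt β ι n), Squarefree n → n.primeFactors.card = r →
      (∀ q ∈ n.primeFactors, (Zhang2014.IsKolyvaginPrime (W.conductorNorm ℤ) W K 2 q ∧ 2 * (M₀ + 6) ≤ Zhang2014.kolyvaginIndex W 2 q) ∧
        (2 * (M₀ + 6) + 1 ≤ Zhang2014.kolyvaginIndex W 2 q ∧
          ∃ (v : HeightOneSpectrum (𝓞 ℚ)) (𝔓 : Ideal (absIntegers (𝓞 ℚ) ℚ)) (h : absoluteGaloisGroup ℚ),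
            (q : 𝓞 ℚ) ∈ v.asIdeal ∧ 𝔓 ∈ v.primesAbove ∧ IsArithFrobAt (𝓞 ℚ) h 𝔓 ∧ ∃ u : geomTorsion W 2, h • u ≠ u)) →
      addOrderOf (d.kolyvaginClass Nat.prime_two (2 * (M₀ + 6))) = 2 ^ (2 * (M₀ + 6) - m) →
      ∀ ℓ₀ ∈ n.primeFactors, ∀ X : Finset ℕ, ∃ ℓ' : ℕ, ℓ' ∉ X ∧ ℓ' ∉ n.primeFactors ∧
        ((Zhang2014.IsKolyvaginPrime (W.conductorNorm ℤ) W K 2 ℓ' ∧ 2 * (M₀ + 6) ≤ Zhang2014.kolyvaginIndex W 2 ℓ') ∧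
          (2 * (M₀ + 6) + 1 ≤ Zhang2014.kolyvaginIndex W 2 ℓ' ∧
            ∃ (v : HeightOneSpectrum (𝓞 ℚ)) (𝔓 : Ideal (absIntegers (𝓞 ℚ) ℚ)) (h : absoluteGaloisGroup ℚ),
              (ℓ' : 𝓞 ℚ) ∈ v.asIdeal ∧ 𝔓 ∈ v.primesAbove ∧ IsArithFrobAt (𝓞 ℚ) h 𝔓 ∧ ∃ u : geomTorsion W 2, h • u ≠ u)) ∧
        (∃ v : HeightOneSpectrum (𝓞 K), ((ℓ' : ℕ) : 𝓞 K) ∈ v.asIdeal ∧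
          ((2 ^ (2 * (M₀ + 6) - m - 1) : ℕ) : ℤ) • d.kolyvaginClass Nat.prime_two (2 * (M₀ + 6)) ∉
            (W.baseChange K).torsionLocalKer (v.adicCompletion K) ((2 ^ (2 * (M₀ + 6)) : ℕ) : ℤ)) ∧
        ∃ d' : KolyvaginHeegnerData Dt β ι (ℓ' * (n / ℓ₀)),
          ((2 ^ (2 * (M₀ + 6) - m - 1) : ℕ) : ℤ) • d'.kolyvaginClass Nat.prime_two (2 * (M₀ + 6)) ≠ 0)
    -- socket 4 (gk2-p4 g24, hK⁺): the eigen index law at a transposition-deep prime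
    (hK : ∀ (r ℓ : ℕ), (Zhang2014.IsKolyvaginPrime (W.conductorNorm ℤ) W K 2 ℓ ∧ 2 * (M₀ + 6) ≤ Zhang2014.kolyvaginIndex W 2 ℓ) ∧
        (2 * (M₀ + 6) + 1 ≤ Zhang2014.kolyvaginIndex W 2 ℓ ∧
          ∃ (v : HeightOneSpectrum (𝓞 ℚ)) (𝔓 : Ideal (absIntegers (𝓞 ℚ) ℚ)) (h : absoluteGaloisGroup ℚ),
            (ℓ : 𝓞 ℚ) ∈ v.asIdeal ∧ 𝔓 ∈ v.primesAbove ∧ IsArithFrobAt (𝓞 ℚ) h 𝔓 ∧ ∃ u : geomTorsion W 2, h • u ≠ u) →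
      ∀ C : AddSubgroup (galH1Torsion (W.baseChange K) ((2 ^ (2 * (M₀ + 6)) : ℕ) : ℤ)),
      (∀ c ∈ C, c ∈ selmerGroup (W.baseChange K) ((2 ^ (2 * (M₀ + 6)) : ℕ) : ℤ) ∧
        conjAct W τ ((2 ^ (2 * (M₀ + 6)) : ℕ) : ℤ) c = (-W.rootNumber * (-1) ^ r) • c) →
      (⨅ (v : HeightOneSpectrum (𝓞 K)) (_ : ((ℓ : ℕ) : 𝓞 K) ∈ v.asIdeal),
          (W.baseChange K).torsionLocalKer (v.adicCompletion K) ((2 ^ (2 * (M₀ + 6)) : ℕ) : ℤ)).relIndex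
        (C ⊓ AddSubgroup.torsionBy (galH1Torsion (W.baseChange K) ((2 ^ (2 * (M₀ + 6)) : ℕ) : ℤ)) (2 : ℤ)) ∣ 2) :
    2 ^ (2 * M₀) ∣ Nat.card (AddCommGroup.primaryComponent (W.baseChange K).sha 2) := by
  haveI : Fact (Nat.Prime 2) := ⟨Nat.prime_two⟩
  haveI : ∀ j : ℕ, NumberField (ringClassField K ι j) := JET.numberField_ringClassField K hIQ ι
  have hsurN : ∀ m : ℕ, W.HasSurjectiveModNGaloisRep ((2 ^ m : ℕ) : ℤ) :=
    MinimalTwinBSDTwo.forall_hasSurjectiveModNGaloisRep_two_pow_of_pos W hρ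
  have hsurN' : ∀ m : ℕ, W.HasSurjectiveModNGaloisRep (2 ^ m : ℕ) := fun m ↦ by exact_mod_cast hsurN m
  -- X-ORTH∃ of (E4)⁺ at `k := M₀ + 6` (sign-free, transposition provenance)
  obtain ⟨B, hker, hOrth⟩ := ctOrthogonalAtTwo_of_frame_transposition W hT K hIQ hodd h3 hHe hρ Dt β ι τ hτ (M₀ + 6) (by omega)
  -- (NPh_{L+1}) from the odd multiplicative place
  have hNPh := NonPhantomPow.nonPhantomAtTwo_of_hasMultiplicativeReductionAt W hT hρ hIQ hodd hsq1 hsq2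
    (NeZero.ne (W.conductorNorm ℤ)) hHe h2v hNv hmult (2 * (M₀ + 6) + 1) (by omega)
  -- KS⁺: the integrator over the transposition-deep margin class, fed with the four sockets
  obtain ⟨R, Mr, hMr, hMr0, hMrR, hOdd, hEven⟩ := kolyvaginSuppliesAtTwo_of_deepSwap_transposition W hQ2 hcm hT hsurN' hIQ hodd h3 hHe τ hτ
    Dt β ι d₁ M₀ hdiv hndiv (L := 2 * (M₀ + 6)) (by omega) 1 (fun z hz hzS ↦ hNPh z hz fun w _ ↦ hzS w) hCheb
    (fun q ↦ 2 * (M₀ + 6) + 1 ≤ Zhang2014.kolyvaginIndex W 2 q ∧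
      ∃ (v : HeightOneSpectrum (𝓞 ℚ)) (𝔓 : Ideal (absIntegers (𝓞 ℚ) ℚ)) (h : absoluteGaloisGroup ℚ),
        (q : 𝓞 ℚ) ∈ v.asIdeal ∧ 𝔓 ∈ v.primesAbove ∧ IsArithFrobAt (𝓞 ℚ) h 𝔓 ∧ ∃ u : geomTorsion W 2, h • u ≠ u)
    (fun q _ hidx hF ↦ ⟨hidx, hF⟩) hbot hswap hK
  -- the sign-free capstone with `Xp = Xm :=` the margin class
  refine pow_dvd_natCard_sha_of_kolyvaginSupplies_of_orthogonal_of_rank_le_one hQ2 W hcm hT K hIQ hodd h3 hHe hrk hρ Dt β ι d₁ hy M₀ hndiv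
    τ hτ (2 * (M₀ + 6)) (M₀ + 6) (by omega) (by omega)
    (fun ℓ ↦ 2 * (M₀ + 6) + 1 ≤ Zhang2014.kolyvaginIndex W 2 ℓ ∧
      ∃ (v : HeightOneSpectrum (𝓞 ℚ)) (𝔓 : Ideal (absIntegers (𝓞 ℚ) ℚ)) (h : absoluteGaloisGroup ℚ),
        (ℓ : 𝓞 ℚ) ∈ v.asIdeal ∧ 𝔓 ∈ v.primesAbove ∧ IsArithFrobAt (𝓞 ℚ) h 𝔓 ∧ ∃ u : geomTorsion W 2, h • u ≠ u)
    (fun ℓ ↦ 2 * (M₀ + 6) + 1 ≤ Zhang2014.kolyvaginIndex W 2 ℓ ∧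
      ∃ (v : HeightOneSpectrum (𝓞 ℚ)) (𝔓 : Ideal (absIntegers (𝓞 ℚ) ℚ)) (h : absoluteGaloisGroup ℚ),
        (ℓ : 𝓞 ℚ) ∈ v.asIdeal ∧ 𝔓 ∈ v.primesAbove ∧ IsArithFrobAt (𝓞 ℚ) h 𝔓 ∧ ∃ u : geomTorsion W 2, h • u ≠ u)
    B hker (fun x x' hx hx' ↦ ?_) R Mr hMr hMr0 hMrR hOdd hEven
  -- X-ORTH in provenance currency: drop the margin (the transposition clause is level-free)
  obtain ⟨n₁, e₁, j₁, hn₁, hKol₁, hj₁, hsel₁, hvan₁, hsg₁, hx₁⟩ := hx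
  obtain ⟨n₂, e₂, j₂, hn₂, hKol₂, hj₂, hsel₂, hvan₂, hsg₂, hx₂⟩ := hx'
  exact hOrth x x'
    ⟨n₁, e₁, j₁, hn₁, fun ℓ hℓ ↦ ⟨(hKol₁ ℓ hℓ).1, (hKol₁ ℓ hℓ).2.1, (hKol₁ ℓ hℓ).2.2.2⟩, hj₁, hsel₁, hvan₁, hsg₁, hx₁⟩
    ⟨n₂, e₂, j₂, hn₂, fun ℓ hℓ ↦ ⟨(hKol₂ ℓ hℓ).1, (hKol₂ ℓ hℓ).2.1, (hKol₂ ℓ hℓ).2.2.2⟩, hj₂, hsel₂, hvan₂, hsg₂, hx₂⟩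


/-! ## §2 (APPEND, same seat) The same ON THE CUT: `rank E(K) ≤ 1` discharged by `…PosTRankLeOnePosCut` -/

/-- **(E4)⁺ ASSEMBLED ON THE Δ>0 CUT modulo the four sockets** — `pow_dvd_natCard_sha_of_sockets_of_rank_le_one_transposition` with `rank E(K) ≤ 1`
DISCHARGED on the cut of L⁺_T′ (`w(E) = 1`, a globally minimal 2-Selmer-minimal twin `Wd`) by this seat's `mordellWeilRank_baseChange_le_one_onPosCut`
(p758733: B2Q⁺ by name ⟹ `rank E(ℚ) = 0` ⟹ `+ rank E^{d_K}(ℚ) ≤ 1`).  With the sockets supplied (hCheb p756802, hK⁺ p756743, hswap⁺ p758726, hbot⁺ gk2-p4 g24)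
this is the body of the by-name closer of stmt-BirchSwinnertonDyer-25501.  BSD is NOT proved by this.
[cite: McCallumLMS1991, §5 Prop. 5.2, Thm. 5.4] [cite: Kolyvagin1991StructureSha] [cite: Kramer1981, Thm. 1] -/
theorem pow_dvd_natCard_sha_of_sockets_onPosCut_transposition (hQ2 : KolyvaginRelationAtTwo)
    (W : WeierstrassCurve ℚ) [W.IsElliptic] [W.IsGloballyMinimal] [NeZero (W.conductorNorm ℤ)] (hcm : ¬ W.HasCM)
    (hT : Odd W.tamagawaProduct) (v : HeightOneSpectrum (𝓞 ℚ)) (h2v : ((2 : ℕ) : 𝓞 ℚ) ∉ v.asIdeal)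
    (hNv : ((W.conductorNorm ℤ : ℕ) : 𝓞 ℚ) ∈ v.asIdeal) (hmult : W.HasMultiplicativeReductionAt v)
    (K : Type) [Field K] [NumberField K] (hIQ : IsImaginaryQuadratic K) (hodd : Odd (NumberField.discr K))
    (h3 : NumberField.discr K ≠ -3) (hHe : SatisfiesHeegnerHypothesis (W.conductorNorm ℤ) K)
    (hsq1 : ¬ IsSquare ((NumberField.discr K : ℚ) * -|W.Δ|)) (hsq2 : ¬ IsSquare ((NumberField.discr K : ℚ) * (-(2 * |W.Δ|))))
    (hρ : ∀ n : ℕ, 0 < n → W.HasSurjectiveModNGaloisRep ((2 : ℤ) ^ n))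
    (Dt : ModularParametrizationData W (W.conductorNorm ℤ)) (β : ℤ) (ι : K →+* ℂ) (d₁ : KolyvaginHeegnerData Dt β ι 1)
    (hy : ¬ IsOfFinAddOrder d₁.derivedPoint) (M₀ : ℕ)
    (hdiv : ∃ Q : (W.baseChange (ringClassField K ι 1)).toAffine.Point, ((2 ^ M₀ : ℕ) : ℤ) • Q = d₁.derivedPoint)
    (hndiv : ¬ ∃ Q : (W.baseChange (ringClassField K ι 1)).toAffine.Point, ((2 ^ (M₀ + 1) : ℕ) : ℤ) • Q = d₁.derivedPoint)
    (hw : W.rootNumber = 1) (Wd : WeierstrassCurve ℚ) [Wd.IsElliptic] [Wd.IsGloballyMinimal]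
    (hWd : ∃ C : VariableChange ℚ, C • W.quadraticTwist (NumberField.discr K : ℚ) = Wd) (hSel : Nat.card (Wd.selmerGroup 2) = 2)
    (τ : K ≃ₐ[ℚ] K) (hτ : τ ≠ 1)
    -- socket 1 (gk2-p5 g32): the deep full-order signed pair Čebotarev at transposition-deep primes, level `L = 2(M₀+6)`, margin `1`
    (hCheb : ∀ (x y : galH1Torsion (W.baseChange K) ((2 ^ (2 * (M₀ + 6)) : ℕ) : ℤ)) {m κ : ℕ}, 1 ≤ m → 1 ≤ κ →
      addOrderOf x = 2 ^ m → addOrderOf y = 2 ^ κ → ∀ {sx sy : ℤ}, (sx = 1 ∨ sx = -1) → (sy = 1 ∨ sy = -1) →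
      conjAct W τ ((2 ^ (2 * (M₀ + 6)) : ℕ) : ℤ) x = sx • x → conjAct W τ ((2 ^ (2 * (M₀ + 6)) : ℕ) : ℤ) y = sy • y →
      (∀ a b : ℤ, (∀ ρ ∈ torsionFixing (W.baseChange K) ((2 ^ (2 * (M₀ + 6) + 1) : ℕ) : ℤ),
        h1Eval (W.baseChange K) ((2 ^ (2 * (M₀ + 6) + 1) : ℕ) : ℤ)
          (torsionH1OfDvd (W.baseChange K) (natCast_pow_dvd_natCast_pow_add 2 (2 * (M₀ + 6)) 1) (a • x + b • y)) ρ = 0) →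
        a • x + b • y = 0) →
      ∀ X : Finset ℕ, ∃ ℓ : ℕ, ℓ ∉ X ∧ Zhang2014.IsKolyvaginPrime (W.conductorNorm ℤ) W K 2 ℓ ∧
        2 * (M₀ + 6) + 1 ≤ Zhang2014.kolyvaginIndex W 2 ℓ ∧
        (∃ (v : HeightOneSpectrum (𝓞 ℚ)) (𝔓 : Ideal (absIntegers (𝓞 ℚ) ℚ)) (h : absoluteGaloisGroup ℚ),
          (ℓ : 𝓞 ℚ) ∈ v.asIdeal ∧ 𝔓 ∈ v.primesAbove ∧ IsArithFrobAt (𝓞 ℚ) h 𝔓 ∧ ∃ u : geomTorsion W 2, h • u ≠ u) ∧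
        ∀ v : HeightOneSpectrum (𝓞 K), (ℓ : 𝓞 K) ∈ v.asIdeal →
          (∀ j : ℕ, ((2 ^ j : ℕ) : ℤ) • x ∈ (W.baseChange K).torsionLocalKer (v.adicCompletion K) ((2 ^ (2 * (M₀ + 6)) : ℕ) : ℤ) ↔ m ≤ j) ∧
          ∀ j : ℕ, ((2 ^ j : ℕ) : ℤ) • y ∈ (W.baseChange K).torsionLocalKer (v.adicCompletion K) ((2 ^ (2 * (M₀ + 6)) : ℕ) : ℤ) ↔ κ ≤ j)
    -- socket 2 (gk2-p3, hbot⁺): a 2-primitive bottom rung in the margin class (from L⁺_T′'s transposition-deep witness `P(n₀) ∉ 2E(K[n₀])`)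
    (hbot : ∃ (n : ℕ) (d : KolyvaginHeegnerData Dt β ι n), Squarefree n ∧
      (∀ q ∈ n.primeFactors, (Zhang2014.IsKolyvaginPrime (W.conductorNorm ℤ) W K 2 q ∧ 2 * (M₀ + 6) ≤ Zhang2014.kolyvaginIndex W 2 q) ∧
        (2 * (M₀ + 6) + 1 ≤ Zhang2014.kolyvaginIndex W 2 q ∧
          ∃ (v : HeightOneSpectrum (𝓞 ℚ)) (𝔓 : Ideal (absIntegers (𝓞 ℚ) ℚ)) (h : absoluteGaloisGroup ℚ),
            (q : 𝓞 ℚ) ∈ v.asIdeal ∧ 𝔓 ∈ v.primesAbove ∧ IsArithFrobAt (𝓞 ℚ) h 𝔓 ∧ ∃ u : geomTorsion W 2, h • u ≠ u)) ∧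
      addOrderOf (d.kolyvaginClass Nat.prime_two (2 * (M₀ + 6))) = 2 ^ (2 * (M₀ + 6)))
    -- socket 3 (gk2-p5 g32, hswap⁺): the exact prime swap at transposition-deep primes
    (hswap : ∀ (r m : ℕ), 1 ≤ r → m < M₀ →
      (∀ (n : ℕ) (e : KolyvaginHeegnerData Dt β ι n), Squarefree n → n.primeFactors.card = r →
        (∀ q ∈ n.primeFactors, (Zhang2014.IsKolyvaginPrime (W.conductorNorm ℤ) W K 2 q ∧ 2 * (M₀ + 6) ≤ Zhang2014.kolyvaginIndex W 2 q) ∧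
          (2 * (M₀ + 6) + 1 ≤ Zhang2014.kolyvaginIndex W 2 q ∧
            ∃ (v : HeightOneSpectrum (𝓞 ℚ)) (𝔓 : Ideal (absIntegers (𝓞 ℚ) ℚ)) (h : absoluteGaloisGroup ℚ),
              (q : 𝓞 ℚ) ∈ v.asIdeal ∧ 𝔓 ∈ v.primesAbove ∧ IsArithFrobAt (𝓞 ℚ) h 𝔓 ∧ ∃ u : geomTorsion W 2, h • u ≠ u)) →
        ((2 ^ (2 * (M₀ + 6) - m) : ℕ) : ℤ) • e.kolyvaginClass Nat.prime_two (2 * (M₀ + 6)) = 0) →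
      ∀ (n : ℕ) (d : KolyvaginHeegnerData Dt β ι n), Squarefree n → n.primeFactors.card = r →
      (∀ q ∈ n.primeFactors, (Zhang2014.IsKolyvaginPrime (W.conductorNorm ℤ) W K 2 q ∧ 2 * (M₀ + 6) ≤ Zhang2014.kolyvaginIndex W 2 q) ∧
        (2 * (M₀ + 6) + 1 ≤ Zhang2014.kolyvaginIndex W 2 q ∧
          ∃ (v : HeightOneSpectrum (𝓞 ℚ)) (𝔓 : Ideal (absIntegers (𝓞 ℚ) ℚ)) (h : absoluteGaloisGroup ℚ),
            (q : 𝓞 ℚ) ∈ v.asIdeal ∧ 𝔓 ∈ v.primesAbove ∧ IsArithFrobAt (𝓞 ℚ) h 𝔓 ∧ ∃ u : geomTorsion W 2, h • u ≠ u)) →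
      addOrderOf (d.kolyvaginClass Nat.prime_two (2 * (M₀ + 6))) = 2 ^ (2 * (M₀ + 6) - m) →
      ∀ ℓ₀ ∈ n.primeFactors, ∀ X : Finset ℕ, ∃ ℓ' : ℕ, ℓ' ∉ X ∧ ℓ' ∉ n.primeFactors ∧
        ((Zhang2014.IsKolyvaginPrime (W.conductorNorm ℤ) W K 2 ℓ' ∧ 2 * (M₀ + 6) ≤ Zhang2014.kolyvaginIndex W 2 ℓ') ∧
          (2 * (M₀ + 6) + 1 ≤ Zhang2014.kolyvaginIndex W 2 ℓ' ∧
            ∃ (v : HeightOneSpectrum (𝓞 ℚ)) (𝔓 : Ideal (absIntegers (𝓞 ℚ) ℚ)) (h : absoluteGaloisGroup ℚ),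
              (ℓ' : 𝓞 ℚ) ∈ v.asIdeal ∧ 𝔓 ∈ v.primesAbove ∧ IsArithFrobAt (𝓞 ℚ) h 𝔓 ∧ ∃ u : geomTorsion W 2, h • u ≠ u)) ∧
        (∃ v : HeightOneSpectrum (𝓞 K), ((ℓ' : ℕ) : 𝓞 K) ∈ v.asIdeal ∧
          ((2 ^ (2 * (M₀ + 6) - m - 1) : ℕ) : ℤ) • d.kolyvaginClass Nat.prime_two (2 * (M₀ + 6)) ∉
            (W.baseChange K).torsionLocalKer (v.adicCompletion K) ((2 ^ (2 * (M₀ + 6)) : ℕ) : ℤ)) ∧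
        ∃ d' : KolyvaginHeegnerData Dt β ι (ℓ' * (n / ℓ₀)),
          ((2 ^ (2 * (M₀ + 6) - m - 1) : ℕ) : ℤ) • d'.kolyvaginClass Nat.prime_two (2 * (M₀ + 6)) ≠ 0)
    -- socket 4 (gk2-p4 g24, hK⁺): the eigen index law at a transposition-deep prime
    (hK : ∀ (r ℓ : ℕ), (Zhang2014.IsKolyvaginPrime (W.conductorNorm ℤ) W K 2 ℓ ∧ 2 * (M₀ + 6) ≤ Zhang2014.kolyvaginIndex W 2 ℓ) ∧
        (2 * (M₀ + 6) + 1 ≤ Zhang2014.kolyvaginIndex W 2 ℓ ∧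
          ∃ (v : HeightOneSpectrum (𝓞 ℚ)) (𝔓 : Ideal (absIntegers (𝓞 ℚ) ℚ)) (h : absoluteGaloisGroup ℚ),
            (ℓ : 𝓞 ℚ) ∈ v.asIdeal ∧ 𝔓 ∈ v.primesAbove ∧ IsArithFrobAt (𝓞 ℚ) h 𝔓 ∧ ∃ u : geomTorsion W 2, h • u ≠ u) →
      ∀ C : AddSubgroup (galH1Torsion (W.baseChange K) ((2 ^ (2 * (M₀ + 6)) : ℕ) : ℤ)),
      (∀ c ∈ C, c ∈ selmerGroup (W.baseChange K) ((2 ^ (2 * (M₀ + 6)) : ℕ) : ℤ) ∧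
        conjAct W τ ((2 ^ (2 * (M₀ + 6)) : ℕ) : ℤ) c = (-W.rootNumber * (-1) ^ r) • c) →
      (⨅ (v : HeightOneSpectrum (𝓞 K)) (_ : ((ℓ : ℕ) : 𝓞 K) ∈ v.asIdeal),
          (W.baseChange K).torsionLocalKer (v.adicCompletion K) ((2 ^ (2 * (M₀ + 6)) : ℕ) : ℤ)).relIndex
        (C ⊓ AddSubgroup.torsionBy (galH1Torsion (W.baseChange K) ((2 ^ (2 * (M₀ + 6)) : ℕ) : ℤ)) (2 : ℤ)) ∣ 2) :
    2 ^ (2 * M₀) ∣ Nat.card (AddCommGroup.primaryComponent (W.baseChange K).sha 2) :=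
  pow_dvd_natCard_sha_of_sockets_of_rank_le_one_transposition hQ2 W hcm hT v h2v hNv hmult K hIQ hodd h3 hHe hsq1 hsq2 hρ Dt β ι d₁ hy M₀ hdiv hndiv
    (mordellWeilRank_baseChange_le_one_onPosCut hQ2 W hcm hT v h2v hNv hmult K hIQ hodd h3 hHe hsq1 hsq2 hρ Dt β ι d₁ hy M₀ hndiv hw Wd hWd hSel)
    τ hτ hCheb hbot hswap hK

end Summit.BirchSwinnertonDyer.BirchSwinnertonDyer.Theorems.GenusExact.PlusDescent

end
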